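import Mathlib
import HarnessLib
import Summits.ValiantsHypothesis.ValiantsHypothesis.Theorems.MonotoneRestorationOrbitRestorationQPSmlAffineSubPermanent
import Summits.ValiantsHypothesis.ValiantsHypothesis.Theorems.MonotoneRestorationOrbitRestorationQPSmlAffinePermanentQP
import Summits.ValiantsHypothesis.ValiantsHypothesis.Theorems.MonotoneRestorationOrbitRestorationQPSharpResiduePolylogDegree

/-!
# The affine set-multilinear stratum at a quasi-polynomial budget does not contain the polylog-degree FLOOR: partial-matching
# polynomials of polylogarithmic order (crux `OrbitRestorationQP`, stmt-ValiantsHypothesis-18293 — lane SML of stub A_∞,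
# calibration)

Namespace `Summit.ValiantsHypothesis.ValiantsHypothesis.Theorems.SmlAffinePermanent`.  Definition-free.

`…SmlAffineSubPermanent.lean`: every affine column-set-multilinear `ΣΠΣ` expression of the ordered partial-matching polynomial
`M_{n,m} = Σ_{g,h : Fin m ↪ Fin n} Π_i x_{(g i, h i)}` has `≥ C(n-j, j)` product gates (`2j ≤ m ≤ n`).  Take the POLYLOGARITHMIC
order `m_c(n) := 2·((log₂ n + c)^c + 1)`: with `j = (log₂ n + c)^c + 1` and `n ≥ n₀(c)` (so that `3j ≤ n`,
`eight_mul_polylog_lt`) the bound is `C(n-j, j) ≥ C(2j, j) ≥ 2^j > 2^((log₂ n + c)^c)`.  So: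

* `two_pow_le_choose_two_mul` — `2^j ≤ C(2j, j)`;
* `subPermanent_polylog_affineColSml_qp_lt` — **for every `c` and all large `n`, every affine column-sml expression of
  `M_{n, m_c(n)}` has MORE than `2^((log₂ n + c)^c)` product gates**;
* `totalDegree_embSum₂_le`, `subPermanent_polylog_qpOrbitRestorable` — while the family `n ↦ M_{n, m_c(n)}` is matrix-symmetric of
  total degree `≤ m_c(n) ≤ (log₂ n + c + 2)^(c+2)`, hence in the polylog-degree floor and quasi-polynomially orbit-restorable with
  ONE constant (`SmlAffineRestoration.qpOrbitRestorable_of_polylogDegree`).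

That is: for every quasi-polynomial budget `2^((log₂ n + c)^c)` there is a restorable — indeed floor-level — matrix-symmetric family
eventually outside the affine column-sml class at that budget; the stratum boundary of lane SML runs INSIDE the trivially
restorable families, not along the restorable/non-restorable divide.  Honest label: calibration of a restricted-model stratum;
nothing here bears on general `ΣΠΣ`, on the registered stubs, or on VP ≠ VNP. [folklore]
-/

noncomputable section

open scoped Classical

-- `Summit.ValiantsHypothesis.ValiantsHypothesis.…` is the tree's single-conjunct layout (Sub = Summit).
set_option linter.dupNamespace false

namespace Summit.ValiantsHypothesis.ValiantsHypothesis.Theorems.SmlAffinePermanent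

open MvPolynomial Finset Equiv OrbitRestorationQPDepthThreeRung

/-- `2^j ≤ C(2j, j)`. [folklore] -/
theorem two_pow_le_choose_two_mul (j : ℕ) : 2 ^ j ≤ Nat.choose (2 * j) j := by
  induction j with
  | zero => simp
  | succ j ih =>
    have h1 : Nat.choose (2 * j + 2) (j + 1) = Nat.choose (2 * j + 1) j + Nat.choose (2 * j + 1) (j + 1) :=
      Nat.choose_succ_succ (2 * j + 1) j
    have h2 : Nat.choose (2 * j + 1) (j + 1) = Nat.choose (2 * j + 1) j := by
      rw [Nat.choose_symm_of_eq_add]; omega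
    have h3 : Nat.choose (2 * j) j ≤ Nat.choose (2 * j + 1) j := Nat.choose_le_choose j (by omega)
    rw [show 2 * (j + 1) = 2 * j + 2 by ring, h1, h2, pow_succ]
    omega

/-- **Polylog-order partial-matching polynomials are outside the affine column-sml class at quasi-polynomial budget.**  For every
`c` and all large `n`: every affine column-set-multilinear `ΣΠΣ` expression of `M_{n, 2((log₂ n + c)^c + 1)}` has more than
`2^((log₂ n + c)^c)` product gates. [folklore] -/
theorem subPermanent_polylog_affineColSml_qp_lt (c : ℕ) : ∃ n₀ : ℕ, ∀ n : ℕ, n₀ ≤ n →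
    ∀ (s : ℕ) (β : Fin s → Fin n → ℂ) (α : Fin s → Fin n → Fin n → ℂ),
      (∑ t : Fin s, ∏ b : Fin n, (C (β t b) + ∑ a : Fin n, C (α t b a) * X (a, b)) :
        MvPolynomial (Fin n × Fin n) ℂ) =
        ∑ g : (Fin (2 * ((Nat.log 2 n + c) ^ c + 1)) ↪ Fin n),
          ∑ h : (Fin (2 * ((Nat.log 2 n + c) ^ c + 1)) ↪ Fin n),
            ∏ i : Fin (2 * ((Nat.log 2 n + c) ^ c + 1)), X (g i, h i) →
      2 ^ ((Nat.log 2 n + c) ^ c) < s := by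
  obtain ⟨n₀, h⟩ := eight_mul_polylog_lt c
  refine ⟨n₀, fun n hn s β α hM => ?_⟩
  have h8 := h n hn
  have hL1 : 1 ≤ (Nat.log 2 n + c) ^ c := by
    rcases Nat.eq_zero_or_pos c with rfl | hc
    · simp
    · exact Nat.one_le_pow _ _ (by omega)
  set L := (Nat.log 2 n + c) ^ c with hL
  have hmn : 2 * (L + 1) ≤ n := by omega
  have hbound := subPermanent_affineColSml_lower_bound (j := L + 1) le_rfl hmn β α hM
  calc 2 ^ L < 2 ^ (L + 1) := Nat.pow_lt_pow_right (by norm_num) (Nat.lt_succ_self L)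
    _ ≤ Nat.choose (2 * (L + 1)) (L + 1) := two_pow_le_choose_two_mul (L + 1)
    _ ≤ Nat.choose (n - (L + 1)) (L + 1) := Nat.choose_le_choose (L + 1) (by omega)
    _ ≤ s := hbound

/-- The total degree of `M_{n,m}` is at most `m`. [folklore] -/
theorem totalDegree_embSum₂_le (n m : ℕ) :
    (∑ g : (Fin m ↪ Fin n), ∑ h : (Fin m ↪ Fin n), ∏ i : Fin m, (X (g i, h i) : MvPolynomial (Fin n × Fin n) ℂ)).totalDegree
      ≤ m := by
  refine (totalDegree_finsetSum _ _).trans (Finset.sup_le fun g _ => ?_)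
  refine (totalDegree_finsetSum _ _).trans (Finset.sup_le fun h _ => ?_)
  refine (totalDegree_finsetProd _ _).trans ?_
  calc ∑ i : Fin m, (X (g i, h i) : MvPolynomial (Fin n × Fin n) ℂ).totalDegree ≤ ∑ _i : Fin m, 1 :=
        Finset.sum_le_sum fun i _ => (totalDegree_X (R := ℂ) (g i, h i)).le
    _ = m := by simp

/-- `2((l + c)^c + 1) ≤ (l + (c+2))^(c+2)`. [folklore] -/
theorem two_mul_polylog_succ_le (l c : ℕ) : 2 * ((l + c) ^ c + 1) ≤ (l + (c + 2)) ^ (c + 2) := by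
  have h1 : (l + c) ^ c ≤ (l + (c + 2)) ^ c := Nat.pow_le_pow_left (by omega) c
  have h2 : 1 ≤ (l + (c + 2)) ^ c := Nat.one_le_pow _ _ (by omega)
  have h3 : 4 ≤ (l + (c + 2)) ^ 2 := by
    have h22 : 2 ≤ l + (c + 2) := by omega
    calc 4 = 2 ^ 2 := by norm_num
      _ ≤ (l + (c + 2)) ^ 2 := Nat.pow_le_pow_left h22 2
  calc 2 * ((l + c) ^ c + 1) ≤ 4 * (l + (c + 2)) ^ c := by omega
    _ ≤ (l + (c + 2)) ^ 2 * (l + (c + 2)) ^ c := Nat.mul_le_mul_right _ h3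
    _ = (l + (c + 2)) ^ (c + 2) := by ring

/-- **… while the same family is in the polylog-degree floor, hence quasi-polynomially orbit-restorable with one constant.**
[folklore] -/
theorem subPermanent_polylog_qpOrbitRestorable (c : ℕ) : ∃ c' : ℕ, ∀ n : ℕ,
    QPOrbitRestorable c' n
      (∑ g : (Fin (2 * ((Nat.log 2 n + c) ^ c + 1)) ↪ Fin n),
        ∑ h : (Fin (2 * ((Nat.log 2 n + c) ^ c + 1)) ↪ Fin n),
          ∏ i : Fin (2 * ((Nat.log 2 n + c) ^ c + 1)), (X (g i, h i) : MvPolynomial (Fin n × Fin n) ℂ)) := by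
  obtain ⟨c', hc'⟩ := SmlAffineRestoration.qpOrbitRestorable_of_polylogDegree (c + 2)
  refine ⟨c', fun n => hc' n _ (fun σ => rename_perm_embSum₂ n _ σ σ) ?_⟩
  exact (totalDegree_embSum₂_le n _).trans (two_mul_polylog_succ_le (Nat.log 2 n) c)

end Summit.ValiantsHypothesis.ValiantsHypothesis.Theorems.SmlAffinePermanent

end
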